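import Literature.MathematicalPhysics.QuantumFieldTheory.Balaban1983to89.B15Prop1MinimiserFamilyAtRecord
import Literature.MathematicalPhysics.QuantumFieldTheory.Balaban1983to89.B15Prop1BaseCriticalityFromMinimiser
import Literature.MathematicalPhysics.QuantumFieldTheory.Balaban1983to89.B15Prop1OntoFromRightInverse
import Literature.MathematicalPhysics.QuantumFieldTheory.Balaban1983to89.B15Prop1SliceNondegeneracyFromRealCoercive

/-!
# `Balaban1983to89.B15Prop1MinimiserFamilyFromRightInverse` — [Balaban1989LargeFieldI] = «[IV]», (1.74) p. 192, Prop. 1 p. 194 (last clause); [Balaban1985Variational] = «[15]», Thm 1 p. 279,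
# Sect. C (45)–(48) p. 285, Sect. F p. 300, Sect. G pp. 305–309, Prop. 9 (190) p. 309; [Balaban1989LargeFieldII] (1.9) p. 359; [Balaban1988Convergent] (2.10)–(2.14) pp. 256–257:
# THE LETTER (J0′) `hMin` FROM THE REDUCED LETTER SET — per base field: a (2.12) MINIMISER (Thm 1 existence), a real RIGHT INVERSE of the linearised averaging from a gauge slice
# ([15] (45)), NONDEGENERACY (β), the criticality transfer (Sect. F), openness of the class; and Thm 1's uniqueness clause

Honest framing: statement-level skeleton of published theorems with citation tags; proofs where landed; nothing here is a claim about the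
Yang–Mills mass gap.  Cell `pub-ymgap`, HUMAN RULING D-0149 (width seats), seat `pub-ymgap-dag-n12-w1` (g2; N12 = [B15]; U1a⁺ of the w1 lineage);
count-neutral; N12 NOT discharged; finite 𝕋⁴ at fixed ε; nothing continuum ∕ OS ∕ mass-gap ∕ Clay.

WHAT.  `B15Prop1MinimiserFamilyAtRecord.hMin_of_baseFieldLetters` with three of its displayed letters DISCHARGED by this lineage: `hclass` (openness pulled back to the matrix topology,
`B15Prop1ClassOpenAtRecord.eventually_coeField_of_eventually`), `hcrit` (`B15Prop1BaseCriticalityFromMinimiser.hcrit_of_isMinimizer`), `honto` (`B15Prop1OntoFromRightInverse.honto_of_rightInverse`).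
What the consumer supplies per base field `V_k ∈ K` (compact): a MINIMAL configuration `U₀` of the (2.12) problem of the base datum `Ū(Q_k^{s*}(ext V_k))` over the class `reg`
(print: [15] Thm 1, existence), OPEN at `U₀` (`∀ᶠ U in 𝓝 U₀, U ∈ reg`; for NODE 00's class: `B15Prop1ClassOpenAtRecord.eventually_mem_regMSCoPOfRecordAt`); the guards below `k`; a
conjugation-stable slice `S`; the REAL RIGHT-INVERSE letter `hH` on `S` in velocity currency ([15] (45)); (β) `hnondeg`; the criticality transfer `hcritT`; and [15] Thm 1's uniqueness clause
`hT1u`.  Conclusion: ONE radius `R > 0` and the three clauses of `hMin` for every `V_k ∈ K`.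

CONTENTS (theorems only; no `def`, no `instance`, no `sorry`).  §1 ★★★ `hMin_of_rightInverseLetters` (any class `reg`, openness displayed).  §2 ★★★ `hMin_atRecord_of_rightInverseLetters` (NODE 00's
averaging and class of record: the openness is a theorem), ★★★ `hMin_atRecord_of_realCoerciveLetters` (the same with (β) in REAL second-variation currency, via
`B15Prop1SliceNondegeneracyFromRealCoercive`).
-/

noncomputable section

namespace Literature.MathematicalPhysics.QuantumFieldTheory.Balaban1983to89.B15Prop1MinimiserFamilyFromRightInverse

open Set Metric Filter
open scoped Topology ContDiff ComplexConjugate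
open Literature.MathematicalPhysics.QuantumFieldTheory.Balaban1983to89.Node00 (SU coeField coeField_apply SmallBelow ConstrSet constrCard constrEnum)
open B15AveragingHolomorphic (iterMh)
open B15ComplexifiedDatumFamily (conjVec datumC datumC_real)
open B15SU2ChartHolomorphic (genE expMulC logCoordC)
open B15Prop1MinimiserFamilyPatching (hMin_of_localCharts)
open B15Prop1CriticalChartFromIFT (datumC_coeField_zero)
open B15Prop1LocalChartAtBaseField (exists_localChart_at_baseField)
open B15Prop1ClassOpenAtRecord (eventually_coeField_of_eventually)
open B15Prop1BaseCriticalityFromMinimiser (hcrit_of_isMinimizer)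
open B15Prop1OntoFromRightInverse (honto_of_rightInverse)
open B15Prop1SliceNondegeneracyFromRealCoercive (hnondeg_slice_of_realSecondVariation_pos)
open Literature.MathematicalPhysics.QuantumFieldTheory.BalabanImbrieJaffe1984to88.BIJ85Eq453GaugeField (qsstarGIter0)
open B15Prop1AnalyticExtClause (cplxVec)
open B15Prop1ChartCalculusSU2 (E3)
open B15Prop1ChartSU2 (su2Chart)
open B15ShellGauge193 (shellGauge)
open B15Extension193 (extend)
open B16Sect1Backgrounds (expMul)
open ExpMeanLog (expMeanLogSU)
open BlockAveraging (blockAvg)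
open T4CubeChartGnomonic (SU2)
open T4Continuum B15DeterminingSets GaugeField
open scoped Matrix.Norms.L2Operator

variable {P : Params} {k : ℕ}

/-- ★★★ **THE LETTER (J0′) `hMin` FROM THE REDUCED PER-BASE-FIELD LETTER SET** (see the module docstring).  Per `V_k ∈ K`, `hbase` packages: a MINIMAL configuration `U₀` of the base
datum's (2.12) problem over `reg`, OPEN at `U₀`; the two guards; a conjugation-stable slice `S`; the action `a` and constraint coordinates `Φ₀` on `S` (pointwise, as in
`B15Prop1LocalChartAtBaseField`); and the DISPLAYED letters `hH` (real right inverse of the linearised averaging from `S`, velocity currency), `hnondeg` ((β); the multiplier is the one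
minimality provides, so the statement quantifies over all `ℓ₀` with `Da(0) = ℓ₀ ∘ DΦ₀(0)`), `hcritT`; and `hT1u`. [cite: Balaban1985Variational, Thm 1 p.279, Sect. C (45),(47)–(48) p.285, Sect. F p.300, Sect. G pp.305–307, Prop. 9 (190) p.309; Balaban1989LargeFieldI, (1.74) p.192, Prop. 1 p.194 (last clause); Balaban1989LargeFieldII, (1.9) p.359; Balaban1988Convergent, (2.10)–(2.14) pp.256–257] -/
theorem hMin_of_rightInverseLetters (Λ : Set (Site P k)) (lo hi : Fin P.d → ℤ)
    (reg : Set (GaugeField P 0 SU2)) (𝔹 : DetSet P) (h𝔹 : ∀ j, k < j → 𝔹 j = ∅)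
    (ext : GaugeField P k SU2 → GaugeField P k SU2) (hext : ∀ W, ext W = extend Λ (shellGauge W lo hi) W)
    {K : Set (GaugeField P k SU2)} (hK : IsCompact K) {𝓐₀ : ℝ} (h𝓐₀ : 1 < 𝓐₀)
    (Crit : GaugeField P 0 SU2 → GaugeField P 0 SU2 → Prop)
    (hbase : ∀ Vk ∈ K, ∃ (U₀ : GaugeField P 0 SU2) (S : Submodule ℂ (VecField P 0 (EuclideanSpace ℂ (Fin 3))))
        (a : S → ℂ) (Φ₀ : S → Fin (constrCard 𝔹 k) → EuclideanSpace ℂ (Fin 3)),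
      -- the base configuration is a MINIMISER of the base datum's (2.12) problem over `reg`, and `reg` is open at it ([15] Thm 1 existence; class (6) open)
      IsMinimizer (fun j => blockAvg (P := P) (j := j) expMeanLogSU) reg 𝔹
        (avgFamily (fun j => blockAvg (P := P) (j := j) expMeanLogSU) (qsstarGIter0 k (ext Vk))) U₀ ∧
      (∀ᶠ U in 𝓝 U₀, U ∈ reg) ∧
      SmallBelow (fun j => blockAvg (P := P) (j := j) expMeanLogSU) k (qsstarGIter0 k (ext Vk)) ∧
      SmallBelow (fun j => blockAvg (P := P) (j := j) expMeanLogSU) k U₀ ∧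
      (∀ X ∈ S, conjVec X ∈ S) ∧
      (∀ X : S, a X = ∑ p : Plaq P 0, (1 - (expMulC (X : VecField P 0 (EuclideanSpace ℂ (Fin 3))) (coeField U₀) ⟨p.src, p.μ⟩ *
        expMulC (X : VecField P 0 (EuclideanSpace ℂ (Fin 3))) (coeField U₀) ⟨p.src.shift p.μ, p.ν⟩ *
        Matrix.adjugate (expMulC (X : VecField P 0 (EuclideanSpace ℂ (Fin 3))) (coeField U₀) ⟨p.src.shift p.ν, p.μ⟩) *
        Matrix.adjugate (expMulC (X : VecField P 0 (EuclideanSpace ℂ (Fin 3))) (coeField U₀) ⟨p.src, p.ν⟩)).trace / 2)) ∧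
      (∀ (X : S) i, Φ₀ X i = logCoordC (star ((avgFamily (fun j => blockAvg (P := P) (j := j) expMeanLogSU) (qsstarGIter0 k (ext Vk))
        ((constrEnum 𝔹 k).symm i).1 ((constrEnum 𝔹 k).symm i).2.1 : SU2) : Matrix (Fin 2) (Fin 2) ℂ) *
        iterMh ((constrEnum 𝔹 k).symm i).1 (expMulC (X : VecField P 0 (EuclideanSpace ℂ (Fin 3))) (coeField U₀)) ((constrEnum 𝔹 k).symm i).2.1)) ∧
      -- DISPLAYED ([15] (45)): a REAL right inverse of the linearised multi-scale averaging from the slice, velocity currency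
      (∀ τ : Fin (constrCard 𝔹 k) → EuclideanSpace ℝ (Fin 3), ∃ p : VecField P 0 E3, cplxVec p ∈ S ∧
        ∀ i : Fin (constrCard 𝔹 k), HasDerivAt (fun s : ℝ => ((avgFamily (fun j => blockAvg (P := P) (j := j) expMeanLogSU) (expMul su2Chart (s • p) U₀)
          ((constrEnum 𝔹 k).symm i).1 ((constrEnum 𝔹 k).symm i).2.1 : SU2) : Matrix (Fin 2) (Fin 2) ℂ))
          (((avgFamily (fun j => blockAvg (P := P) (j := j) expMeanLogSU) (qsstarGIter0 k (ext Vk)) ((constrEnum 𝔹 k).symm i).1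
            ((constrEnum 𝔹 k).symm i).2.1 : SU2) : Matrix (Fin 2) (Fin 2) ℂ) * ∑ b : Fin 3, ((τ i b : ℝ) : ℂ) • genE b) 0) ∧
      -- DISPLAYED ((β)): the Lagrange Hessian is nondegenerate on `ker DΦ₀(0)`, for every multiplier of the base state
      (∀ ℓ₀ : (Fin (constrCard 𝔹 k) → EuclideanSpace ℂ (Fin 3)) →L[ℂ] ℂ, fderiv ℂ a 0 = ℓ₀.comp (fderiv ℂ Φ₀ 0) →
        ∀ s : S, fderiv ℂ Φ₀ 0 s = 0 →
          (∀ t : S, fderiv ℂ Φ₀ 0 t = 0 → fderiv ℂ (fderiv ℂ a) 0 s t - ℓ₀ (fderiv ℂ (fderiv ℂ Φ₀) 0 s t) = 0) → s = 0) ∧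
      -- DISPLAYED ([15] Sect. F): criticality transfer
      (∀ᶠ w in 𝓝 ((0 : S), coeField (qsstarGIter0 k (ext Vk))), ∀ (U' Q' : GaugeField P 0 SU2) (μ : (Fin (constrCard 𝔹 k) → EuclideanSpace ℂ (Fin 3)) →L[ℂ] ℂ),
        expMulC (w.1 : VecField P 0 (EuclideanSpace ℂ (Fin 3))) (coeField U₀) = coeField U' → coeField Q' = w.2 →
          AgreeOn 𝔹 (avgFamily (fun j => blockAvg (P := P) (j := j) expMeanLogSU) U') (avgFamily (fun j => blockAvg (P := P) (j := j) expMeanLogSU) Q') →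
          fderiv ℂ a w.1 = μ.comp (fderiv ℂ Φ₀ w.1) → Crit Q' U'))
    -- [15] Thm 1's uniqueness clause near each base datum (DISPLAYED)
    (hT1u : ∀ Vk ∈ K, ∀ᶠ Q in 𝓝 (coeField (qsstarGIter0 k (ext Vk))), ∀ U' Q' : GaugeField P 0 SU2, coeField Q' = Q →
      U' ∈ reg → AgreeOn 𝔹 (avgFamily (fun j => blockAvg (P := P) (j := j) expMeanLogSU) U') (avgFamily (fun j => blockAvg (P := P) (j := j) expMeanLogSU) Q') →
        Crit Q' U' → IsMinimizer (fun j => blockAvg (P := P) (j := j) expMeanLogSU) reg 𝔹 (avgFamily (fun j => blockAvg (P := P) (j := j) expMeanLogSU) Q') U') :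
    ∃ R : ℝ, 0 < R ∧ ∀ Vk ∈ K,
      ∃ Ũ : VecField P k (EuclideanSpace ℂ (Fin 3)) × VecField P k (EuclideanSpace ℂ (Fin 3)) → PBond P 0 → Matrix (Fin 2) (Fin 2) ℂ,
        (∀ b i j, DifferentiableOn ℂ (fun z => Ũ z b i j) (ball 0 R)) ∧
        (∀ z ∈ ball (0 : VecField P k (EuclideanSpace ℂ (Fin 3)) × VecField P k (EuclideanSpace ℂ (Fin 3))) R, ∀ b i j, ‖Ũ z b i j‖ ≤ 𝓐₀) ∧
        ∀ p B' : VecField P k E3, ‖p‖ < R → ‖B'‖ < R → ∃ U' : GaugeField P 0 SU2,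
          (∀ b, Ũ (cplxVec p, cplxVec B') b = ((U' b : SU2) : Matrix (Fin 2) (Fin 2) ℂ)) ∧
            IsMinimizer (fun j => blockAvg (P := P) (j := j) expMeanLogSU) reg 𝔹
              (avgFamily (fun j => blockAvg (P := P) (j := j) expMeanLogSU) (qsstarGIter0 k (expMul su2Chart B' (ext (expMul su2Chart p Vk))))) U' := by
  refine hMin_of_localCharts Λ lo hi (fun j => blockAvg (P := P) (j := j) expMeanLogSU) reg 𝔹 ext hK fun Vk hVk => ?_
  obtain ⟨U₀, S, a, Φ₀, hmin, hregopen, hsbQ, hsbU, hS, ha, hΦ₀, hH, hnondeg, hcritT⟩ := hbase Vk hVk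
  have hU₀ : AgreeOn 𝔹 (avgFamily (fun j => blockAvg (P := P) (j := j) expMeanLogSU) U₀)
      (avgFamily (fun j => blockAvg (P := P) (j := j) expMeanLogSU) (qsstarGIter0 k (ext Vk))) := hmin.2.1
  -- the datum coordinates, pointwise
  set κ : (PBond P 0 → Matrix (Fin 2) (Fin 2) ℂ) → Fin (constrCard 𝔹 k) → EuclideanSpace ℂ (Fin 3) := fun Q i =>
    logCoordC (star ((avgFamily (fun j => blockAvg (P := P) (j := j) expMeanLogSU) (qsstarGIter0 k (ext Vk)) ((constrEnum 𝔹 k).symm i).1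
      ((constrEnum 𝔹 k).symm i).2.1 : SU2) : Matrix (Fin 2) (Fin 2) ℂ) * iterMh ((constrEnum 𝔹 k).symm i).1 Q ((constrEnum 𝔹 k).symm i).2.1) with hκdef
  have hκ : ∀ Q i, κ Q i = logCoordC (star ((avgFamily (fun j => blockAvg (P := P) (j := j) expMeanLogSU) (qsstarGIter0 k (ext Vk)) ((constrEnum 𝔹 k).symm i).1
      ((constrEnum 𝔹 k).symm i).2.1 : SU2) : Matrix (Fin 2) (Fin 2) ℂ) * iterMh ((constrEnum 𝔹 k).symm i).1 Q ((constrEnum 𝔹 k).symm i).2.1) := fun Q i => rfl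
  have hΦ₀κ : ∀ X : S, Φ₀ X = κ (expMulC (X : VecField P 0 (EuclideanSpace ℂ (Fin 3))) (coeField U₀)) := fun X => funext fun i => by rw [hΦ₀, hκ]
  -- `honto` from the right inverse, `hcrit` from minimality, `hclass` from openness
  have honto : Function.Surjective (fderiv ℂ Φ₀ 0) :=
    honto_of_rightInverse 𝔹 k _ κ hκ hsbU hU₀ S Φ₀ hΦ₀κ hH
  obtain ⟨ℓ₀, hcrit⟩ := hcrit_of_isMinimizer 𝔹 k h𝔹 reg hsbQ hsbU hmin hregopen S hS a ha Φ₀ hΦ₀ honto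
  have hclass : ∀ᶠ Q in 𝓝 (coeField U₀), ∀ U' : GaugeField P 0 SU2, coeField U' = Q → U' ∈ reg := eventually_coeField_of_eventually hregopen
  -- the local chart at this base field, then the bookkeeping of `hMin_of_localCharts`
  obtain ⟨O, hO, hmem, Γ, hΓd, hΓb, hΓr⟩ := exists_localChart_at_baseField 𝔹 k h𝔹 reg hsbQ hsbU hU₀ S hS a ha Φ₀ hΦ₀ hcrit honto (hnondeg ℓ₀ hcrit)
    Crit hclass hcritT (hT1u Vk hVk) h𝓐₀
  refine ⟨O, hO, by rwa [datumC_coeField_zero Λ lo hi ext hext], Γ, hΓd, hΓb, fun p B' Vk' hQ' => ?_⟩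
  have hreal : datumC Λ lo hi (coeField Vk') (cplxVec p) (cplxVec B') =
      coeField (qsstarGIter0 k (expMul su2Chart B' (ext (expMul su2Chart p Vk')))) := by
    rw [datumC_real, ← hext]
  rw [hreal] at hQ' ⊢
  exact hΓr _ hQ'

/-! ## §2  At NODE 00's class of record: the openness of the class is a theorem (`B15Prop1ClassOpenAtRecord`) -/

section Record

variable {F : T4Family} {k : ℕ}

/-- ★★★ **THE LETTER (J0′) `hMin` AT NODE 00's OBJECTS FROM THE REDUCED LETTER SET** — `hMin_of_rightInverseLetters` at the averaging of record `Node00.avOfRecord F 2 Kt` and print's class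
(6) of record `Node00.regMSCoPOfRecord F 2 ν Kt kc Ω` (any `kc`, `Ω`), where the openness of the class at the minimiser is a THEOREM (`eventually_mem_regMSCoPOfRecordAt`, n07-e's
curve-openness of (1.7)∕(1.9)).  Per base field the consumer supplies: a MINIMISER `U₀` ([15] Thm 1 existence), the guards, a conjugation-stable slice `S` with the pointwise `a`, `Φ₀`,
the real right inverse `hH` ([15] (45)), (β) `hnondeg`, the criticality transfer `hcritT`; and `hT1u`. [cite: Balaban1985Variational, Thm 1 p.279, (2),(6) p.278, Sect. C (45) p.285, Sect. F p.300, Prop. 9 (190) p.309; Balaban1989LargeFieldI, (1.74) p.192, Prop. 1 p.194; Balaban1988Convergent, (2.12) p.256] -/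
theorem hMin_atRecord_of_rightInverseLetters (ν : Node00.Stage7Numerics) (Kt kc : ℕ) (Ω : ℕ → Set (Site (F.P Kt) 0))
    (Λ : Set (Site (F.P Kt) k)) (lo hi : Fin (F.P Kt).d → ℤ) (𝔹 : DetSet (F.P Kt)) (h𝔹 : ∀ j, k < j → 𝔹 j = ∅)
    (ext : GaugeField (F.P Kt) k SU2 → GaugeField (F.P Kt) k SU2) (hext : ∀ W, ext W = extend Λ (shellGauge W lo hi) W)
    {K : Set (GaugeField (F.P Kt) k SU2)} (hK : IsCompact K) {𝓐₀ : ℝ} (h𝓐₀ : 1 < 𝓐₀)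
    (Crit : GaugeField (F.P Kt) 0 SU2 → GaugeField (F.P Kt) 0 SU2 → Prop)
    (hbase : ∀ Vk ∈ K, ∃ (U₀ : GaugeField (F.P Kt) 0 SU2) (S : Submodule ℂ (VecField (F.P Kt) 0 (EuclideanSpace ℂ (Fin 3))))
        (a : S → ℂ) (Φ₀ : S → Fin (constrCard 𝔹 k) → EuclideanSpace ℂ (Fin 3)),
      IsMinimizer (Node00.avOfRecord F 2 Kt) (Node00.regMSCoPOfRecord F 2 ν Kt kc Ω) 𝔹
        (avgFamily (Node00.avOfRecord F 2 Kt) (qsstarGIter0 k (ext Vk))) U₀ ∧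
      SmallBelow (Node00.avOfRecord F 2 Kt) k (qsstarGIter0 k (ext Vk)) ∧
      SmallBelow (Node00.avOfRecord F 2 Kt) k U₀ ∧
      (∀ X ∈ S, conjVec X ∈ S) ∧
      (∀ X : S, a X = ∑ p : Plaq (F.P Kt) 0, (1 - (expMulC (X : VecField (F.P Kt) 0 (EuclideanSpace ℂ (Fin 3))) (coeField U₀) ⟨p.src, p.μ⟩ *
        expMulC (X : VecField (F.P Kt) 0 (EuclideanSpace ℂ (Fin 3))) (coeField U₀) ⟨p.src.shift p.μ, p.ν⟩ *
        Matrix.adjugate (expMulC (X : VecField (F.P Kt) 0 (EuclideanSpace ℂ (Fin 3))) (coeField U₀) ⟨p.src.shift p.ν, p.μ⟩) *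
        Matrix.adjugate (expMulC (X : VecField (F.P Kt) 0 (EuclideanSpace ℂ (Fin 3))) (coeField U₀) ⟨p.src, p.ν⟩)).trace / 2)) ∧
      (∀ (X : S) i, Φ₀ X i = logCoordC (star ((avgFamily (Node00.avOfRecord F 2 Kt) (qsstarGIter0 k (ext Vk))
        ((constrEnum 𝔹 k).symm i).1 ((constrEnum 𝔹 k).symm i).2.1 : SU2) : Matrix (Fin 2) (Fin 2) ℂ) *
        iterMh ((constrEnum 𝔹 k).symm i).1 (expMulC (X : VecField (F.P Kt) 0 (EuclideanSpace ℂ (Fin 3))) (coeField U₀)) ((constrEnum 𝔹 k).symm i).2.1)) ∧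
      (∀ τ : Fin (constrCard 𝔹 k) → EuclideanSpace ℝ (Fin 3), ∃ p : VecField (F.P Kt) 0 E3, cplxVec p ∈ S ∧
        ∀ i : Fin (constrCard 𝔹 k), HasDerivAt (fun s : ℝ => ((avgFamily (Node00.avOfRecord F 2 Kt) (expMul su2Chart (s • p) U₀)
          ((constrEnum 𝔹 k).symm i).1 ((constrEnum 𝔹 k).symm i).2.1 : SU2) : Matrix (Fin 2) (Fin 2) ℂ))
          (((avgFamily (Node00.avOfRecord F 2 Kt) (qsstarGIter0 k (ext Vk)) ((constrEnum 𝔹 k).symm i).1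
            ((constrEnum 𝔹 k).symm i).2.1 : SU2) : Matrix (Fin 2) (Fin 2) ℂ) * ∑ b : Fin 3, ((τ i b : ℝ) : ℂ) • genE b) 0) ∧
      (∀ ℓ₀ : (Fin (constrCard 𝔹 k) → EuclideanSpace ℂ (Fin 3)) →L[ℂ] ℂ, fderiv ℂ a 0 = ℓ₀.comp (fderiv ℂ Φ₀ 0) →
        ∀ s : S, fderiv ℂ Φ₀ 0 s = 0 →
          (∀ t : S, fderiv ℂ Φ₀ 0 t = 0 → fderiv ℂ (fderiv ℂ a) 0 s t - ℓ₀ (fderiv ℂ (fderiv ℂ Φ₀) 0 s t) = 0) → s = 0) ∧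
      (∀ᶠ w in 𝓝 ((0 : S), coeField (qsstarGIter0 k (ext Vk))), ∀ (U' Q' : GaugeField (F.P Kt) 0 SU2) (μ : (Fin (constrCard 𝔹 k) → EuclideanSpace ℂ (Fin 3)) →L[ℂ] ℂ),
        expMulC (w.1 : VecField (F.P Kt) 0 (EuclideanSpace ℂ (Fin 3))) (coeField U₀) = coeField U' → coeField Q' = w.2 →
          AgreeOn 𝔹 (avgFamily (Node00.avOfRecord F 2 Kt) U') (avgFamily (Node00.avOfRecord F 2 Kt) Q') →
          fderiv ℂ a w.1 = μ.comp (fderiv ℂ Φ₀ w.1) → Crit Q' U'))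
    (hT1u : ∀ Vk ∈ K, ∀ᶠ Q in 𝓝 (coeField (qsstarGIter0 k (ext Vk))), ∀ U' Q' : GaugeField (F.P Kt) 0 SU2, coeField Q' = Q →
      U' ∈ Node00.regMSCoPOfRecord F 2 ν Kt kc Ω → AgreeOn 𝔹 (avgFamily (Node00.avOfRecord F 2 Kt) U') (avgFamily (Node00.avOfRecord F 2 Kt) Q') →
        Crit Q' U' → IsMinimizer (Node00.avOfRecord F 2 Kt) (Node00.regMSCoPOfRecord F 2 ν Kt kc Ω) 𝔹 (avgFamily (Node00.avOfRecord F 2 Kt) Q') U') :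
    ∃ R : ℝ, 0 < R ∧ ∀ Vk ∈ K,
      ∃ Ũ : VecField (F.P Kt) k (EuclideanSpace ℂ (Fin 3)) × VecField (F.P Kt) k (EuclideanSpace ℂ (Fin 3)) → PBond (F.P Kt) 0 → Matrix (Fin 2) (Fin 2) ℂ,
        (∀ b i j, DifferentiableOn ℂ (fun z => Ũ z b i j) (ball 0 R)) ∧
        (∀ z ∈ ball (0 : VecField (F.P Kt) k (EuclideanSpace ℂ (Fin 3)) × VecField (F.P Kt) k (EuclideanSpace ℂ (Fin 3))) R, ∀ b i j, ‖Ũ z b i j‖ ≤ 𝓐₀) ∧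
        ∀ p B' : VecField (F.P Kt) k E3, ‖p‖ < R → ‖B'‖ < R → ∃ U' : GaugeField (F.P Kt) 0 SU2,
          (∀ b, Ũ (cplxVec p, cplxVec B') b = ((U' b : SU2) : Matrix (Fin 2) (Fin 2) ℂ)) ∧
            IsMinimizer (Node00.avOfRecord F 2 Kt) (Node00.regMSCoPOfRecord F 2 ν Kt kc Ω) 𝔹
              (avgFamily (Node00.avOfRecord F 2 Kt) (qsstarGIter0 k (expMul su2Chart B' (ext (expMul su2Chart p Vk))))) U' :=
  hMin_of_rightInverseLetters Λ lo hi (Node00.regMSCoPOfRecord F 2 ν Kt kc Ω) 𝔹 h𝔹 ext hext hK h𝓐₀ Crit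
    (fun Vk hVk => by
      obtain ⟨U₀, S, a, Φ₀, hmin, hsbQ, hsbU, hS, ha, hΦ₀, hH, hnondeg, hcritT⟩ := hbase Vk hVk
      exact ⟨U₀, S, a, Φ₀, hmin, B15Prop1ClassOpenAtRecord.eventually_mem_regMSCoPOfRecordAt F 2 ν Kt kc _ Ω hmin.1, hsbQ, hsbU, hS, ha, hΦ₀, hH, hnondeg, hcritT⟩)
    hT1u

/-- ★★★ **THE LETTER (J0′) `hMin` AT NODE 00's OBJECTS WITH (β) IN REAL SECOND-VARIATION CURRENCY** — `hMin_atRecord_of_rightInverseLetters` with the complex nondegeneracy letter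
replaced, per base field and per multiplier `ℓ₀` of the base state (`Da(0) = ℓ₀ ∘ DΦ₀(0)`), by POSITIVITY OF THE REAL SECOND VARIATION along every non-zero real slice field `p`
(`cplxVec p ∈ S`) in the kernel of the linearised constraint:
`0 < d²∕dt² [ wilsonAction4 (expMul su2Chart (t • p) U₀) − Re ℓ₀ (Φ₀ ((t:ℂ) • ⟨cplxVec p, _⟩)) ] |₀` — the currency of the sibling lanes' (β) estimates
(`B16Ineq19NearFlatSlice.h17_nearFlat`, `B16Ineq17NearFlatOneSided.lagrangeHessian_ge_flatMin_sub`); the reduction is `B15Prop1SliceNondegeneracyFromRealCoercive` over n12-w2's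
`LagrangeHessianRealCoercive.hnondeg_of_re_pos`.  Remaining DISPLAYED per base field: the MINIMISER `U₀` ([15] Thm 1 existence), the guards, the slice `S` with the real right inverse
`hH` ([15] (45)), this real (β) positivity, the criticality transfer `hcritT`; and `hT1u`. [cite: Balaban1989LargeFieldII, (1.9) p.358, (1.12) p.359, p.359; Balaban1985Variational, Thm 1 p.279, Sect. C (45) p.285, Sect. F p.300, Sect. G pp.305–307, Prop. 9 (190) p.309; Balaban1989LargeFieldI, (1.74) p.192, Prop. 1 p.194; Balaban1988Convergent, (2.12) p.256] -/
theorem hMin_atRecord_of_realCoerciveLetters (ν : Node00.Stage7Numerics) (Kt kc : ℕ) (Ω : ℕ → Set (Site (F.P Kt) 0))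
    (Λ : Set (Site (F.P Kt) k)) (lo hi : Fin (F.P Kt).d → ℤ) (𝔹 : DetSet (F.P Kt)) (h𝔹 : ∀ j, k < j → 𝔹 j = ∅)
    (ext : GaugeField (F.P Kt) k SU2 → GaugeField (F.P Kt) k SU2) (hext : ∀ W, ext W = extend Λ (shellGauge W lo hi) W)
    {K : Set (GaugeField (F.P Kt) k SU2)} (hK : IsCompact K) {𝓐₀ : ℝ} (h𝓐₀ : 1 < 𝓐₀)
    (Crit : GaugeField (F.P Kt) 0 SU2 → GaugeField (F.P Kt) 0 SU2 → Prop)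
    (hbase : ∀ Vk ∈ K, ∃ (U₀ : GaugeField (F.P Kt) 0 SU2) (S : Submodule ℂ (VecField (F.P Kt) 0 (EuclideanSpace ℂ (Fin 3))))
        (a : S → ℂ) (Φ₀ : S → Fin (constrCard 𝔹 k) → EuclideanSpace ℂ (Fin 3)),
      IsMinimizer (Node00.avOfRecord F 2 Kt) (Node00.regMSCoPOfRecord F 2 ν Kt kc Ω) 𝔹
        (avgFamily (Node00.avOfRecord F 2 Kt) (qsstarGIter0 k (ext Vk))) U₀ ∧
      SmallBelow (Node00.avOfRecord F 2 Kt) k (qsstarGIter0 k (ext Vk)) ∧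
      SmallBelow (Node00.avOfRecord F 2 Kt) k U₀ ∧
      (∀ X ∈ S, conjVec X ∈ S) ∧
      (∀ X : S, a X = ∑ p : Plaq (F.P Kt) 0, (1 - (expMulC (X : VecField (F.P Kt) 0 (EuclideanSpace ℂ (Fin 3))) (coeField U₀) ⟨p.src, p.μ⟩ *
        expMulC (X : VecField (F.P Kt) 0 (EuclideanSpace ℂ (Fin 3))) (coeField U₀) ⟨p.src.shift p.μ, p.ν⟩ *
        Matrix.adjugate (expMulC (X : VecField (F.P Kt) 0 (EuclideanSpace ℂ (Fin 3))) (coeField U₀) ⟨p.src.shift p.ν, p.μ⟩) *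
        Matrix.adjugate (expMulC (X : VecField (F.P Kt) 0 (EuclideanSpace ℂ (Fin 3))) (coeField U₀) ⟨p.src, p.ν⟩)).trace / 2)) ∧
      (∀ (X : S) i, Φ₀ X i = logCoordC (star ((avgFamily (Node00.avOfRecord F 2 Kt) (qsstarGIter0 k (ext Vk))
        ((constrEnum 𝔹 k).symm i).1 ((constrEnum 𝔹 k).symm i).2.1 : SU2) : Matrix (Fin 2) (Fin 2) ℂ) *
        iterMh ((constrEnum 𝔹 k).symm i).1 (expMulC (X : VecField (F.P Kt) 0 (EuclideanSpace ℂ (Fin 3))) (coeField U₀)) ((constrEnum 𝔹 k).symm i).2.1)) ∧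
      -- DISPLAYED ([15] (45)): a REAL right inverse of the linearised multi-scale averaging from the slice, velocity currency
      (∀ τ : Fin (constrCard 𝔹 k) → EuclideanSpace ℝ (Fin 3), ∃ p : VecField (F.P Kt) 0 E3, cplxVec p ∈ S ∧
        ∀ i : Fin (constrCard 𝔹 k), HasDerivAt (fun s : ℝ => ((avgFamily (Node00.avOfRecord F 2 Kt) (expMul su2Chart (s • p) U₀)
          ((constrEnum 𝔹 k).symm i).1 ((constrEnum 𝔹 k).symm i).2.1 : SU2) : Matrix (Fin 2) (Fin 2) ℂ))
          (((avgFamily (Node00.avOfRecord F 2 Kt) (qsstarGIter0 k (ext Vk)) ((constrEnum 𝔹 k).symm i).1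
            ((constrEnum 𝔹 k).symm i).2.1 : SU2) : Matrix (Fin 2) (Fin 2) ℂ) * ∑ b : Fin 3, ((τ i b : ℝ) : ℂ) • genE b) 0) ∧
      -- DISPLAYED ((β), REAL currency): positivity of the real second variation of the Lagrangian along real slice fields in the kernel, for every multiplier of the base state
      (∀ ℓ₀ : (Fin (constrCard 𝔹 k) → EuclideanSpace ℂ (Fin 3)) →L[ℂ] ℂ, fderiv ℂ a 0 = ℓ₀.comp (fderiv ℂ Φ₀ 0) →
        ∀ (p : VecField (F.P Kt) 0 E3) (hp : cplxVec p ∈ S), p ≠ 0 → fderiv ℂ Φ₀ 0 ⟨cplxVec p, hp⟩ = 0 →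
          0 < deriv (deriv (fun t : ℝ => wilsonAction4 (expMul su2Chart (t • p) U₀) - (ℓ₀ (Φ₀ ((t : ℂ) • ⟨cplxVec p, hp⟩))).re)) 0) ∧
      -- DISPLAYED ([15] Sect. F): criticality transfer
      (∀ᶠ w in 𝓝 ((0 : S), coeField (qsstarGIter0 k (ext Vk))), ∀ (U' Q' : GaugeField (F.P Kt) 0 SU2) (μ : (Fin (constrCard 𝔹 k) → EuclideanSpace ℂ (Fin 3)) →L[ℂ] ℂ),
        expMulC (w.1 : VecField (F.P Kt) 0 (EuclideanSpace ℂ (Fin 3))) (coeField U₀) = coeField U' → coeField Q' = w.2 →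
          AgreeOn 𝔹 (avgFamily (Node00.avOfRecord F 2 Kt) U') (avgFamily (Node00.avOfRecord F 2 Kt) Q') →
          fderiv ℂ a w.1 = μ.comp (fderiv ℂ Φ₀ w.1) → Crit Q' U'))
    (hT1u : ∀ Vk ∈ K, ∀ᶠ Q in 𝓝 (coeField (qsstarGIter0 k (ext Vk))), ∀ U' Q' : GaugeField (F.P Kt) 0 SU2, coeField Q' = Q →
      U' ∈ Node00.regMSCoPOfRecord F 2 ν Kt kc Ω → AgreeOn 𝔹 (avgFamily (Node00.avOfRecord F 2 Kt) U') (avgFamily (Node00.avOfRecord F 2 Kt) Q') →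
        Crit Q' U' → IsMinimizer (Node00.avOfRecord F 2 Kt) (Node00.regMSCoPOfRecord F 2 ν Kt kc Ω) 𝔹 (avgFamily (Node00.avOfRecord F 2 Kt) Q') U') :
    ∃ R : ℝ, 0 < R ∧ ∀ Vk ∈ K,
      ∃ Ũ : VecField (F.P Kt) k (EuclideanSpace ℂ (Fin 3)) × VecField (F.P Kt) k (EuclideanSpace ℂ (Fin 3)) → PBond (F.P Kt) 0 → Matrix (Fin 2) (Fin 2) ℂ,
        (∀ b i j, DifferentiableOn ℂ (fun z => Ũ z b i j) (ball 0 R)) ∧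
        (∀ z ∈ ball (0 : VecField (F.P Kt) k (EuclideanSpace ℂ (Fin 3)) × VecField (F.P Kt) k (EuclideanSpace ℂ (Fin 3))) R, ∀ b i j, ‖Ũ z b i j‖ ≤ 𝓐₀) ∧
        ∀ p B' : VecField (F.P Kt) k E3, ‖p‖ < R → ‖B'‖ < R → ∃ U' : GaugeField (F.P Kt) 0 SU2,
          (∀ b, Ũ (cplxVec p, cplxVec B') b = ((U' b : SU2) : Matrix (Fin 2) (Fin 2) ℂ)) ∧
            IsMinimizer (Node00.avOfRecord F 2 Kt) (Node00.regMSCoPOfRecord F 2 ν Kt kc Ω) 𝔹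
              (avgFamily (Node00.avOfRecord F 2 Kt) (qsstarGIter0 k (expMul su2Chart B' (ext (expMul su2Chart p Vk))))) U' :=
  hMin_atRecord_of_rightInverseLetters ν Kt kc Ω Λ lo hi 𝔹 h𝔹 ext hext hK h𝓐₀ Crit
    (fun Vk hVk => by
      obtain ⟨U₀, S, a, Φ₀, hmin, hsbQ, hsbU, hS, ha, hΦ₀, hH, hpos, hcritT⟩ := hbase Vk hVk
      exact ⟨U₀, S, a, Φ₀, hmin, hsbQ, hsbU, hS, ha, hΦ₀, hH, fun ℓ₀ hℓ₀ =>
        hnondeg_slice_of_realSecondVariation_pos 𝔹 k _ hsbU hmin.2.1 S hS a ha Φ₀ hΦ₀ ℓ₀ (hpos ℓ₀ hℓ₀), hcritT⟩)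
    hT1u

end Record

end Literature.MathematicalPhysics.QuantumFieldTheory.Balaban1983to89.B15Prop1MinimiserFamilyFromRightInverse

end
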